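import Literature.NumberTheory.PAdicHodge.UnramifiedCompletionEmbedding
import Literature.NumberTheory.GaloisRepresentations.AbsGaloisGroup
import Mathlib.Topology.Algebra.UniformRing
import Mathlib.Analysis.SpecialFunctions.Pow.Continuity
import HarnessLib

/-!
# `ℂ_K ≅ ℂ_L` along the chosen `K̄ ≅ L̄`, and `𝒪_{ℂ_K} ≅ 𝒪_{ℂ_L}`

Let `K`, `L` be non-archimedean local fields with an algebra structure `Algebra K L`, let
`ι = absClosureEmbedding K L : K̄ →ₐ[K] L̄` be the tree's chosen `K`-embedding of algebraic closures
and `res = absGaloisRestrict K L : Γ_L → Γ_K` the induced restriction of absolute Galois groups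
(`ι (res τ • x) = τ • ι x`, `GaloisRepresentations/AbsGaloisGroup.lean`).  Write
`ℂ_F = CompletedAlgClosure F` for the completion of `F̄` for its absolute value
`‖·‖_{F̄} = algNorm F` (`PAdicHodge/CompletedAlgClosure.lean`) and `𝒪_{ℂ_F} = integerC F` for its
closed unit ball with the restricted `Γ_F`-action `galInt`
(`PAdicHodge/UnramifiedCompletionEmbedding.lean`).

Assume that `ι` is bijective and is a homothety in the exponent for the absolute values,
`‖ι x‖_{L̄} = ‖x‖_{K̄} ^ c` for a real `c > 0` (both hold for a continuous embedding of `p`-adic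
fields `K → L`; they are proved in `PAdicHodge/LocalFieldEmbeddingNorm.lean` and are taken here as
hypotheses).  We prove:

* `uniformContinuous_of_norm_map_eq_rpow` — an additive homomorphism of seminormed groups with
  `‖f x‖ = ‖x‖ ^ c`, `c > 0`, is uniformly continuous.
* `exists_completedAlgClosure_ringEquiv` — **`ℂ_K ≅ ℂ_L`**: `ι` extends (uniquely, by uniform
  continuity of `ι` and `ι⁻¹`) to an isomorphism of complete valued fields `e : ℂ_K ≃+* ℂ_L` with
  `‖e x‖ = ‖x‖ ^ c` and `e (res τ • x) = τ • e x` (Mathlib `UniformSpace.Completion.mapRingEquiv`;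
  the norm law and the equivariance pass from the dense subfield `K̄` to `ℂ_K` by continuity).
* `exists_integerC_ringEquiv` — **`𝒪_{ℂ_K} ≅ 𝒪_{ℂ_L}`**: since `c > 0`, `e` maps the unit ball
  onto the unit ball, giving `g : 𝒪_{ℂ_K} ≃+* 𝒪_{ℂ_L}` with `g ∘ galInt (res τ) = galInt τ ∘ g`.

This is the input of the transport of Fontaine's construction `B_dR⁺ = B_dR⁺(𝒪_{ℂ_K})` from `K` to
`L`: the construction of `B_dR⁺` only depends on the ring `𝒪_{ℂ_K}` with its `G_K`-action
(Brinon–Conrad, discussion before Prop. 6.3.8), so an equivariant isomorphism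
`𝒪_{ℂ_K} ≅ 𝒪_{ℂ_L}` over `res : G_L → G_K` identifies `B_dR(K)|_{G_L}` with `B_dR(L)`.

Sources: J.-M. Fontaine, *Le corps des périodes p-adiques*, Astérisque 223 (1994), Exp. II,
§1.1–1.2 (`C = \widehat{K̄}`, functoriality of the completion in the valued field `K̄`);
O. Brinon, B. Conrad, *CMI Summer School notes on p-adic Hodge theory* (2009), the discussion
before Prop. 6.3.8 ("the construction of `B_dR⁺` only depends on `𝒪_{ℂ_K}` with its
`G_K`-action").

NOT here: the bijectivity of `ι` and the norm law `‖ι x‖ = ‖x‖ ^ c` (hypotheses; see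
`LocalFieldEmbeddingNorm.lean`); the transport of `B_dR⁺`, `B_dR` or of admissibility along `g`
(separate files); any identification of `ℂ_K` with Mathlib's `ℂ_[p]`.
-/

open Field ValuativeRel UniformSpace

namespace Literature.NumberTheory.PAdicHodge

open Literature.NumberTheory.GaloisRepresentations
open Literature.NumberTheory.GaloisRepresentations.IsNonarchimedeanLocalField

/-- **Homotheties in the exponent are uniformly continuous.**  An additive homomorphism `f` of
seminormed groups with `‖f x‖ = ‖x‖ ^ c` for a real `c > 0` is uniformly continuous:
`‖f x - f y‖ = ‖x - y‖ ^ c < ε` as soon as `‖x - y‖ < ε ^ (1/c)`. [folklore] -/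
theorem uniformContinuous_of_norm_map_eq_rpow {A B F : Type*} [SeminormedAddCommGroup A]
    [SeminormedAddCommGroup B] [FunLike F A B] [AddMonoidHomClass F A B] (f : F) {c : ℝ}
    (hc : 0 < c) (hf : ∀ x, ‖f x‖ = ‖x‖ ^ c) : UniformContinuous f := by
  refine Metric.uniformContinuous_iff.2 fun ε hε => ⟨ε ^ c⁻¹, Real.rpow_pos_of_pos hε _, ?_⟩
  intro a b hab
  rw [dist_eq_norm] at hab
  rw [dist_eq_norm, ← map_sub, hf]
  calc ‖a - b‖ ^ c < (ε ^ c⁻¹) ^ c := Real.rpow_lt_rpow (norm_nonneg _) hab hc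
    _ = ε := Real.rpow_inv_rpow hε.le hc.ne'

variable {K L : Type} [Field K] [ValuativeRel K] [TopologicalSpace K] [IsNonarchimedeanLocalField K]
  [Field L] [ValuativeRel L] [TopologicalSpace L] [IsNonarchimedeanLocalField L] [Algebra K L]

/-- **`ℂ_K ≅ ℂ_L` along `ι : K̄ ≅ L̄`.**  If the chosen embedding `ι = absClosureEmbedding K L` is
bijective and satisfies `‖ι x‖_{L̄} = ‖x‖_{K̄} ^ c` with `c > 0`, then `ι` and `ι⁻¹` are uniformly
continuous, so `ι` extends to a ring isomorphism `e : ℂ_K ≃+* ℂ_L` of the completions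
(`e ∘ (K̄ → ℂ_K) = (L̄ → ℂ_L) ∘ ι`), which satisfies the same norm law `‖e x‖ = ‖x‖ ^ c` and is
equivariant for `res = absGaloisRestrict K L`: `e (res τ • x) = τ • e x` (both identities hold on
the dense subfield `K̄` and both sides are continuous).  Fontaine, Astérisque 223, Exp. II §1.1–1.2
(`C = \widehat{K̄}` is functorial in the valued field `K̄` with its Galois action).
[cite: FontaineAsterisque223III, Exp. II §1.2] -/
theorem exists_completedAlgClosure_ringEquiv (hbij : Function.Bijective (absClosureEmbedding K L))
    {c : ℝ} (hc : 0 < c)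
    (hcx : ∀ x : AlgebraicClosure K, algNorm L (absClosureEmbedding K L x) = algNorm K x ^ c) :
    ∃ e : CompletedAlgClosure K ≃+* CompletedAlgClosure L,
      (∀ y : AlgebraicClosure K,
          e (algClosureToC K y) = algClosureToC L (absClosureEmbedding K L y)) ∧
      (∀ x : CompletedAlgClosure K, ‖e x‖ = ‖x‖ ^ c) ∧
      ∀ (τ : absoluteGaloisGroup L) (x : CompletedAlgClosure K),
        e (absGaloisRestrict K L τ • x) = τ • e x := by
  -- Step 1: `ι` as a ring isomorphism `K̄ ≃+* L̄` of the normed synonyms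
  obtain ⟨ι, hι⟩ : ∃ ι : NormedAlgClosure K ≃+* NormedAlgClosure L, ∀ x,
      NormedAlgClosure.toAlgClosure (ι x) =
        absClosureEmbedding K L (NormedAlgClosure.toAlgClosure x) :=
    ⟨(NormedAlgClosure.toAlgClosure (F := K)).toRingEquiv.trans
      ((RingEquiv.ofBijective (absClosureEmbedding K L) hbij).trans
        (NormedAlgClosure.toAlgClosure (F := L)).toRingEquiv.symm), fun _ => rfl⟩
  -- its norm law, the norm law of its inverse, and its equivariance
  have hι_norm : ∀ x, ‖ι x‖ = ‖x‖ ^ c := fun x => by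
    rw [NormedAlgClosure.norm_def, NormedAlgClosure.norm_def, hι, hcx]
  have hιs_norm : ∀ y, ‖ι.symm y‖ = ‖y‖ ^ c⁻¹ := fun y => by
    have h := hι_norm (ι.symm y)
    rw [RingEquiv.apply_symm_apply] at h
    rw [h, Real.rpow_rpow_inv (norm_nonneg _) hc.ne']
  have hι_smul : ∀ (τ : absoluteGaloisGroup L) (x : NormedAlgClosure K),
      ι (absGaloisRestrict K L τ • x) = τ • ι x := fun τ x => by
    apply (NormedAlgClosure.toAlgClosure (F := L)).injective
    simp only [hι, NormedAlgClosure.toAlgClosure_smul, absGaloisRestrict_apply_smul]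
  -- Step 2: `ι`, `ι⁻¹` are uniformly continuous, so `ι` extends to `e : ℂ_K ≃+* ℂ_L`
  have hιu : UniformContinuous ι := uniformContinuous_of_norm_map_eq_rpow ι hc hι_norm
  have hιsu : UniformContinuous ι.symm :=
    uniformContinuous_of_norm_map_eq_rpow ι.symm (inv_pos.2 hc) hιs_norm
  obtain ⟨e, he⟩ : ∃ e : CompletedAlgClosure K ≃+* CompletedAlgClosure L,
      ∀ x, e x = Completion.map ι x :=
    ⟨Completion.mapRingEquiv ι hιu.continuous hιsu.continuous,
      Completion.mapRingEquiv_apply ι _ _⟩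
  have he_coe : ∀ a : NormedAlgClosure K,
      e (a : CompletedAlgClosure K) = ((ι a : NormedAlgClosure L) : CompletedAlgClosure L) :=
    fun a => by rw [he, Completion.map_coe hιu]
  have he_cont : Continuous e := Completion.continuous_map.congr fun x => (he x).symm
  -- Step 3: the norm law on `ℂ_K`, by density of `K̄`
  have he_norm : ∀ x : CompletedAlgClosure K, ‖e x‖ = ‖x‖ ^ c := fun x => by
    refine Completion.induction_on x
      (isClosed_eq (continuous_norm.comp he_cont)
        (continuous_norm.rpow_const fun _ => Or.inr hc.le)) fun a => ?_
    rw [he_coe, Completion.norm_coe, Completion.norm_coe, hι_norm]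
  -- Step 4: equivariance on `ℂ_K`, by density of `K̄`
  have he_smul : ∀ (τ : absoluteGaloisGroup L) (x : CompletedAlgClosure K),
      e (absGaloisRestrict K L τ • x) = τ • e x := fun τ x => by
    refine Completion.induction_on x
      (isClosed_eq (he_cont.comp (CompletedAlgClosure.continuous_constSMul _))
        ((CompletedAlgClosure.continuous_constSMul τ).comp he_cont)) fun a => ?_
    rw [CompletedAlgClosure.smul_coe, he_coe, he_coe, CompletedAlgClosure.smul_coe, hι_smul]
  refine ⟨e, fun y => ?_, he_norm, he_smul⟩
  -- `e` extends `ι`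
  rw [algClosureToC_apply, algClosureToC_apply, he_coe]
  congr 1
  apply (NormedAlgClosure.toAlgClosure (F := L)).injective
  rw [hι, AlgEquiv.apply_symm_apply, AlgEquiv.apply_symm_apply]

/-- **`𝒪_{ℂ_K} ≅ 𝒪_{ℂ_L}`, equivariantly.**  If the chosen embedding `ι = absClosureEmbedding K L`
is bijective and multiplies absolute values in the exponent (`‖ι x‖_{L̄} = ‖x‖_{K̄} ^ c`, `c > 0`),
then there is a ring isomorphism `g : 𝒪_{ℂ_K} ≃+* 𝒪_{ℂ_L}` of the closed unit balls of the completed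
algebraic closures intertwining the Galois actions through `res = absGaloisRestrict K L`:
`g (galInt (res τ) x) = galInt τ (g x)`.  It is the restriction of the isomorphism `ℂ_K ≅ ℂ_L`
extending `ι` (`exists_completedAlgClosure_ringEquiv`), which preserves `‖·‖ ≤ 1` because
`‖e x‖ = ‖x‖ ^ c`.  This is what makes Fontaine's `B_dR⁺(𝒪_{ℂ_K})` with its `G_K`-action restricted
to `G_L` isomorphic to `B_dR⁺(𝒪_{ℂ_L})` (Brinon–Conrad: "the construction of `B_dR⁺` only depends on
`𝒪_{ℂ_K}` with its `G_K`-action").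
[cite: BrinonConrad2009, Prop. 6.3.8] -/
theorem exists_integerC_ringEquiv (hbij : Function.Bijective (absClosureEmbedding K L))
    (hc : ∃ c : ℝ, 0 < c ∧ ∀ x : AlgebraicClosure K,
      algNorm L (absClosureEmbedding K L x) = algNorm K x ^ c) :
    ∃ g : integerC K ≃+* integerC L, ∀ (τ : absoluteGaloisGroup L) (x : integerC K),
      g (galInt (absGaloisRestrict K L τ) x) = galInt τ (g x) := by
  obtain ⟨c, hc, hcx⟩ := hc
  obtain ⟨e, -, he_norm, he_smul⟩ := exists_completedAlgClosure_ringEquiv hbij hc hcx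
  -- `e` maps the unit ball onto the unit ball (`c > 0`)
  have hmem : ∀ x : CompletedAlgClosure K, x ∈ integerC K ↔ e x ∈ integerC L := fun x => by
    rw [mem_integerC_iff, mem_integerC_iff, he_norm]
    simpa only [Real.one_rpow] using
      (Real.rpow_le_rpow_iff (norm_nonneg x) zero_le_one hc).symm
  -- the restriction of `e` to the unit balls
  obtain ⟨g, hg⟩ : ∃ g : integerC K ≃+* integerC L,
      ∀ x : integerC K, ((g x : integerC L) : CompletedAlgClosure L) = e x :=
    ⟨{ (e.toEquiv.subtypeEquiv hmem : integerC K ≃ integerC L) with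
        map_mul' := fun x y =>
          Subtype.ext (map_mul e (x : CompletedAlgClosure K) (y : CompletedAlgClosure K))
        map_add' := fun x y =>
          Subtype.ext (map_add e (x : CompletedAlgClosure K) (y : CompletedAlgClosure K)) },
      fun _ => rfl⟩
  refine ⟨g, fun τ x => Subtype.ext ?_⟩
  rw [hg, coe_galInt, coe_galInt, hg, he_smul]

end Literature.NumberTheory.PAdicHodge
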